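import Summits.ValiantsHypothesis.ValiantsHypothesis.Theses.KPlusLogSqLaw
import Summits.ValiantsHypothesis.ValiantsHypothesis.Theorems.KPlusLogSqLawRegimeCollapse
import Summits.ValiantsHypothesis.ValiantsHypothesis.Theorems.KPlusLogSqLawLiftingFixedClasses

/-!
# Route «KPlusLogSqLaw» — crux `WeakLifting`: the Descartes zone OFF the window, the reduction TO the window,
# and the WEAK DIAGONAL (custody item #2W)

HONEST FRAMING.  Helper file for the load-bearing lifting crux `WeakLifting` (stmt-ValiantsHypothesis-19561, route
`KPlusLogSqLaw` rev 8, cell `pub-symmetroid`; seat val-sym-lift-p4 (g2), 2026-08-26).  Part 1 is a list of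
DESCARTES-ZONE theorems (no hypothesis, no tropical input); parts 2–3 are IMPLICATIONS / EQUIVALENCES between statements
that are OPEN (Conjecture B = `KPlusLogSqLaw`, `WeakLifting`, `TropicalB`, their window and diagonal restrictions).
Nothing here asserts `WeakLifting`, `TropicalB`, Conjecture B, `MatrixDescartes` (stmt-ValiantsHypothesis-18050) or
anything about VP ≠ VNP.  Notation: `L = ⌊log₂ m⌋ = Nat.log 2 m`; the WINDOW of parameter `c` is the set of formats
`c·L < K` and `2^c·K < m` (i.e. `c·log₂ m < K < m / 2^c`); `W` below is `WeakLifting` in its tree-row form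
`∃ C, ∀ m K n, TropRootLawAt m K n → RealRootLawAt m K (2^(C (K + L²))·(n+1))` (δ-equal to the route declaration,
`Iff.rfl`, exactly as in `…WeakLiftingBridge` / `…RegimeCollapse`).

CONTENTS (all proved).
1. OFF THE WINDOW, B AND W ARE DESCARTES THEOREMS (conjb-3's F1/F1′ in kernel form, every `c`):
   `realRootLawAt_thinLog` (`K ≤ c·L ⇒ ζ_tot(m,K) ≤ 2^((c+1)(K+L²))`, from the polynomial row `2(m+1)^(K−1) − 1`),
   `realRootLawAt_fatCone` (`m ≤ 2^c·K ⇒ ζ_tot(m,K) ≤ 2^((2^c+1)(K+L²))`, from `2·C(m+K−1,m) − 1 ≤ 2^(m+K)`),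
   `kPlusLogSqLaw_offWindow`, `weakLifting_offWindow` (the weak-lifting inequality with NO tropical input off the window),
   `kPlusLogSqLaw_boundedSize` / `weakLifting_boundedSize` (every bounded-`m` strip, all `K` — the «fixed `m`» rungs; the
   «fixed `K`» rungs are `TropicalCensus.kPlusLogSqLaw_boundedK` / `weakLifting_boundedK` of `…LiftingFixedClasses`).
2. REDUCTION TO THE WINDOW (every `c`): `kPlusLogSqLaw_iff_window`, `weakLifting_iff_window` (tree-row form) and
   `weakLifting_iff_window'` (route declaration): only the window formats `c·L < K < m/2^c` carry either statement.
3. THE WEAK DIAGONAL `W_diag := ∃ C, ∀ s n, TropRootLawAt (2^s) (s²) n → RealRootLawAt (2^s) (s²) (2^(C s²)·(n+1))`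
   (custody item #2W of the desk, lead R1418 (b); equivalence with `W` is NOT claimed unconditionally — the tropical
   hypothesis is anti-monotone in the format, so the padding of `…RegimeCollapse` does not apply):
   `weakLiftDiag_of_weakLifting` (`W → W_diag`), `kPlusLogSqLaw_of_tropDiag_of_weakLiftDiag` (`TB_diag → W_diag → B`, via
   `kPlusLogSqLaw_iff_diagonal`), `kPlusLogSqLaw_iff_tropDiag_and_weakLiftDiag` (**B ⟺ TB_diag ∧ W_diag**: Conjecture B is the
   conjunction of two statements about the single format sequence `(2^s, s²)`), `weakLifting_iff_weakLiftDiag_of_tropicalB`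
   (`TropicalB → (WeakLifting ↔ W_diag)`), `weakLifting_iff_kPlusLogSqLaw_of_tropicalB` (given TB, W is B — the bridge p417903
   read as an `↔`).  (The same reading of the skeleton's plan-only BC5 rung `stub_weakLiftRungEdge` — modulo `TropicalB` the
   edge rung is Conjecture B itself — is `kPlusLogSqLaw_of_tropicalB_of_weakLiftEdge` / `weakLiftEdge_iff_kPlusLogSqLaw_of_tropicalB`
   of the sibling file `…WeakLiftingRegimeCollapse` (val-sym-trop-p4 g2), not restated here: its «per-window Descartes budget» half
   is where B lives; the «window localisation» half, GAP-LIFT §7, is a theorem and the subject of a separate file.)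
[folklore] Descartes' rule of signs + stars and bars; padding / monotonicity bookkeeping; the conjectures themselves are
the cell's (no citation exists).
-/

set_option linter.dupNamespace false
set_option autoImplicit false

namespace Summit.ValiantsHypothesis.ValiantsHypothesis.Theorems.KPlusLogSqLaw

open Summit.ValiantsHypothesis.ValiantsHypothesis.Theses.KPlusLogSqLaw (TropicalB WeakLifting)
open Summit.ValiantsHypothesis.ValiantsHypothesis.Theorems.LacunarySymmetroidMatrixDescartes (RealRootLawAt KPlusLogSqLaw)
open Summit.ValiantsHypothesis.ValiantsHypothesis.Theorems.LacunarySymmetroidMatrixDescartes.Census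
  (realRootLawAt_mono realRootLawAt_descartes)
open Summit.ValiantsHypothesis.ValiantsHypothesis.Theorems.LacunarySymmetroidMatrixDescartes.TropicalCensus
  (TropRootLawAt TropKPlusLogSqLaw realRootLawAt_zero realRootLawAt_poly kPlusLogSqLaw_boundedK
    weakLifting_of_kPlusLogSqLaw tropKPlusLogSqLaw_of_kPlusLogSqLaw kPlusLogSqLaw_of_weakLifting_of_tropKPlusLogSqLaw)

/-- `2^E + 1 ≤ 2^(E+1)`. [folklore] -/
theorem two_pow_add_one_le (E : ℕ) : 2 ^ E + 1 ≤ 2 ^ (E + 1) := by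
  have := Nat.one_le_two_pow (n := E)
  rw [Nat.pow_succ]; omega

/-! ## 1. Off the window: Descartes-zone rows in the `K + log² m` currency (no hypothesis) -/

/-- **Thin-log strip** (`K ≤ c·⌊log₂ m⌋`): `ζ_tot(m,K) ≤ 2^((c+1)·(K + ⌊log₂ m⌋²))`, from the polynomial real row
`2(m+1)^(K−1) − 1` (`TropicalCensus.realRootLawAt_poly`) and `m + 1 ≤ 2^(L+1)`:
`(L+1)(K−1) + 1 ≤ (L+1)K ≤ c L² + K`. [folklore] -/
theorem realRootLawAt_thinLog (c m K : ℕ) (hK : K ≤ c * Nat.log 2 m) :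
    RealRootLawAt m K (2 ^ ((c + 1) * (K + Nat.log 2 m ^ 2))) := by
  rcases Nat.eq_zero_or_pos K with rfl | hK0
  · exact realRootLawAt_zero m _
  refine realRootLawAt_mono ?_ (realRootLawAt_poly m K hK0)
  set L := Nat.log 2 m with hL
  have h1 : (m + 1) ^ (K - 1) ≤ (2 ^ (L + 1)) ^ (K - 1) :=
    Nat.pow_le_pow_left (Nat.lt_pow_succ_log_self one_lt_two m) _
  rw [← pow_mul] at h1
  have h2 : 2 * (m + 1) ^ (K - 1) - 1 ≤ 2 ^ ((L + 1) * (K - 1) + 1) := by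
    rw [pow_succ]; omega
  refine h2.trans (Nat.pow_le_pow_right two_pos ?_)
  have h3 : (L + 1) * (K - 1) + 1 ≤ (L + 1) * K := by
    have e : (L + 1) * (K - 1) + (L + 1) = (L + 1) * K := by
      rw [← Nat.mul_succ, Nat.succ_eq_add_one, Nat.sub_add_cancel hK0]
    omega
  have h4 : L * K ≤ c * L ^ 2 := by
    calc L * K ≤ L * (c * L) := Nat.mul_le_mul_left L hK
      _ = c * L ^ 2 := by ring
  have e1 : (L + 1) * K = L * K + K := by ring
  have e2 : (c + 1) * (K + L ^ 2) = c * K + K + c * L ^ 2 + L ^ 2 := by ring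
  omega

/-- **Fat cone** (`m ≤ 2^c·K`): `ζ_tot(m,K) ≤ 2^((2^c+1)·(K + ⌊log₂ m⌋²))`, from Descartes
`2·C(m+K−1, m) − 1 ≤ 2^(m+K)`. [folklore] -/
theorem realRootLawAt_fatCone (c m K : ℕ) (hm : m ≤ 2 ^ c * K) :
    RealRootLawAt m K (2 ^ ((2 ^ c + 1) * (K + Nat.log 2 m ^ 2))) := by
  rcases Nat.eq_zero_or_pos K with rfl | hK0
  · exact realRootLawAt_zero m _
  refine realRootLawAt_mono ?_ (realRootLawAt_descartes m K hK0)
  have h1 : Nat.choose (m + K - 1) m ≤ 2 ^ (m + K - 1) := Nat.choose_le_two_pow _ _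
  have h2 : 2 * 2 ^ (m + K - 1) = 2 ^ (m + K) := by
    rw [← pow_succ']; congr 1; omega
  have e : (2 ^ c + 1) * (K + Nat.log 2 m ^ 2) = 2 ^ c * K + K + (2 ^ c + 1) * Nat.log 2 m ^ 2 := by ring
  have h3 : 2 ^ (m + K) ≤ 2 ^ ((2 ^ c + 1) * (K + Nat.log 2 m ^ 2)) :=
    Nat.pow_le_pow_right two_pos (by rw [e]; omega)
  omega

/-- **Conjecture B off the window, every `c`** (no hypothesis): `C = 2^c + 1` works on all formats with
`K ≤ c·⌊log₂ m⌋` or `m ≤ 2^c·K`.  This is the cell's «B is Descartes-trivial outside the window `c·log₂ m < K < m/2^c`»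
(conjb-3 F1/F1′) in kernel form. [folklore] -/
theorem kPlusLogSqLaw_offWindow (c : ℕ) : ∃ C : ℕ, ∀ m K : ℕ, (K ≤ c * Nat.log 2 m ∨ m ≤ 2 ^ c * K) →
    RealRootLawAt m K (2 ^ (C * (K + Nat.log 2 m ^ 2))) := by
  refine ⟨2 ^ c + 1, fun m K h => ?_⟩
  rcases h with h | h
  · refine realRootLawAt_mono (Nat.pow_le_pow_right two_pos ?_) (realRootLawAt_thinLog c m K h)
    have hc : c + 1 ≤ 2 ^ c + 1 := Nat.add_le_add_right (Nat.lt_two_pow_self).le _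
    exact Nat.mul_le_mul_right _ hc
  · exact realRootLawAt_fatCone c m K h

/-- **The weak-lifting inequality off the window, every `c`, with NO tropical input.** [folklore] -/
theorem weakLifting_offWindow (c : ℕ) : ∃ C : ℕ, ∀ m K n : ℕ, (K ≤ c * Nat.log 2 m ∨ m ≤ 2 ^ c * K) →
    TropRootLawAt m K n → RealRootLawAt m K (2 ^ (C * (K + Nat.log 2 m ^ 2)) * (n + 1)) := by
  obtain ⟨C, hC⟩ := kPlusLogSqLaw_offWindow c
  exact ⟨C, fun m K n h _ => realRootLawAt_mono (Nat.le_mul_of_pos_right _ (Nat.succ_pos n)) (hC m K h)⟩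

/-- **Conjecture B on every bounded-`m` strip, all `K`** (no hypothesis): `K ≥ m` is the fat cone `c = 0`,
`K ≤ m ≤ m₀` the bounded-`K` strip of `TropicalCensus.kPlusLogSqLaw_boundedK`. [folklore] -/
theorem kPlusLogSqLaw_boundedSize (m₀ : ℕ) :
    ∃ C : ℕ, ∀ m K : ℕ, m ≤ m₀ → RealRootLawAt m K (2 ^ (C * (K + Nat.log 2 m ^ 2))) := by
  obtain ⟨C₁, h₁⟩ := kPlusLogSqLaw_boundedK m₀
  obtain ⟨C₂, h₂⟩ := kPlusLogSqLaw_offWindow 0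
  refine ⟨C₁ + C₂, fun m K hm => ?_⟩
  rcases le_total K m with hKm | hmK
  · exact realRootLawAt_mono (Nat.pow_le_pow_right two_pos (Nat.mul_le_mul_right _ (Nat.le_add_right _ _)))
      (h₁ m K (hKm.trans hm))
  · refine realRootLawAt_mono (Nat.pow_le_pow_right two_pos (Nat.mul_le_mul_right _ (Nat.le_add_left _ _)))
      (h₂ m K (Or.inr ?_))
    simpa using hmK

/-- **The weak-lifting inequality on every bounded-`m` strip, all `K`, with NO tropical input** (the «fixed `m`» rungs of
`WeakLifting`; Descartes zone). [folklore] -/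
theorem weakLifting_boundedSize (m₀ : ℕ) :
    ∃ C : ℕ, ∀ m K n : ℕ, m ≤ m₀ → TropRootLawAt m K n →
      RealRootLawAt m K (2 ^ (C * (K + Nat.log 2 m ^ 2)) * (n + 1)) := by
  obtain ⟨C, hC⟩ := kPlusLogSqLaw_boundedSize m₀
  exact ⟨C, fun m K n hm _ => realRootLawAt_mono (Nat.le_mul_of_pos_right _ (Nat.succ_pos n)) (hC m K hm)⟩

/-! ## 2. Reduction to the window `c·log₂ m < K < m / 2^c` (every `c`) -/

/-- **B ⟺ B on the window** (every `c`): Conjecture B holds iff some `C` bounds `ζ_tot(m,K)` by `2^(C(K+L²))` on the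
window formats `c·L < K`, `2^c·K < m` alone. [folklore] -/
theorem kPlusLogSqLaw_iff_window (c : ℕ) :
    KPlusLogSqLaw ↔ ∃ C : ℕ, ∀ m K : ℕ, c * Nat.log 2 m < K → 2 ^ c * K < m →
      RealRootLawAt m K (2 ^ (C * (K + Nat.log 2 m ^ 2))) := by
  constructor
  · rintro ⟨C, hC⟩
    exact ⟨C, fun m K _ _ => hC m K⟩
  · rintro ⟨C₁, h₁⟩
    obtain ⟨C₂, h₂⟩ := kPlusLogSqLaw_offWindow c
    refine ⟨C₁ + C₂, fun m K => ?_⟩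
    by_cases hw : c * Nat.log 2 m < K ∧ 2 ^ c * K < m
    · exact realRootLawAt_mono (Nat.pow_le_pow_right two_pos (Nat.mul_le_mul_right _ (Nat.le_add_right _ _)))
        (h₁ m K hw.1 hw.2)
    · have h : K ≤ c * Nat.log 2 m ∨ m ≤ 2 ^ c * K := by
        rw [not_and_or, not_lt, not_lt] at hw; exact hw
      exact realRootLawAt_mono (Nat.pow_le_pow_right two_pos (Nat.mul_le_mul_right _ (Nat.le_add_left _ _)))
        (h₂ m K h)

/-- **W ⟺ W on the window** (tree-row form, every `c`). [folklore] -/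
theorem weakLifting_iff_window (c : ℕ) :
    (∃ C : ℕ, ∀ m K n : ℕ, TropRootLawAt m K n →
        RealRootLawAt m K (2 ^ (C * (K + Nat.log 2 m ^ 2)) * (n + 1))) ↔
      ∃ C : ℕ, ∀ m K n : ℕ, c * Nat.log 2 m < K → 2 ^ c * K < m → TropRootLawAt m K n →
        RealRootLawAt m K (2 ^ (C * (K + Nat.log 2 m ^ 2)) * (n + 1)) := by
  constructor
  · rintro ⟨C, hC⟩
    exact ⟨C, fun m K n _ _ => hC m K n⟩
  · rintro ⟨C₁, h₁⟩
    obtain ⟨C₂, h₂⟩ := weakLifting_offWindow c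
    refine ⟨C₁ + C₂, fun m K n hT => ?_⟩
    by_cases hw : c * Nat.log 2 m < K ∧ 2 ^ c * K < m
    · exact realRootLawAt_mono (Nat.mul_le_mul_right _
        (Nat.pow_le_pow_right two_pos (Nat.mul_le_mul_right _ (Nat.le_add_right _ _)))) (h₁ m K n hw.1 hw.2 hT)
    · have h : K ≤ c * Nat.log 2 m ∨ m ≤ 2 ^ c * K := by
        rw [not_and_or, not_lt, not_lt] at hw; exact hw
      exact realRootLawAt_mono (Nat.mul_le_mul_right _
        (Nat.pow_le_pow_right two_pos (Nat.mul_le_mul_right _ (Nat.le_add_left _ _)))) (h₂ m K n h hT)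

/-- **`WeakLifting` ⟺ `WeakLifting` on the window** (the route declaration, stmt-ValiantsHypothesis-19561, every `c`):
the crux is carried entirely by the window formats `c·log₂ m < K < m / 2^c`. [folklore] -/
theorem weakLifting_iff_window' (c : ℕ) :
    WeakLifting ↔
      ∃ C : ℕ, ∀ m K n : ℕ, c * Nat.log 2 m < K → 2 ^ c * K < m → TropRootLawAt m K n →
        RealRootLawAt m K (2 ^ (C * (K + Nat.log 2 m ^ 2)) * (n + 1)) :=
  weakLifting_iff_window c

/-! ## 3. The weak diagonal `W_diag` (custody item #2W), read against `TropicalB` -/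

/-- **`W → W_diag`** (`C ↦ 2C`; on the diagonal `K + ⌊log₂ m⌋² = 2 s²`). [folklore] -/
theorem weakLiftDiag_of_weakLifting
    (hW : ∃ C : ℕ, ∀ m K n : ℕ, TropRootLawAt m K n →
      RealRootLawAt m K (2 ^ (C * (K + Nat.log 2 m ^ 2)) * (n + 1))) :
    ∃ C : ℕ, ∀ s n : ℕ, TropRootLawAt (2 ^ s) (s ^ 2) n →
      RealRootLawAt (2 ^ s) (s ^ 2) (2 ^ (C * s ^ 2) * (n + 1)) := by
  obtain ⟨C, hC⟩ := hW
  refine ⟨2 * C, fun s n hT => ?_⟩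
  have h := hC (2 ^ s) (s ^ 2) n hT
  have e : C * (s ^ 2 + Nat.log 2 (2 ^ s) ^ 2) = 2 * C * s ^ 2 := by rw [log_two_pow]; ring
  rw [e] at h
  exact h

/-- **`TB_diag → W_diag → B`**: the tropical diagonal law and the weak diagonal give Conjecture B's diagonal row
(`2^(C_W s²)·(2^(C_T s²) + 1) ≤ 2^((C_W + C_T + 1) s²)`), hence B on all formats by `kPlusLogSqLaw_iff_diagonal`
(real-side padding, `…RegimeCollapse`). [folklore] -/
theorem kPlusLogSqLaw_of_tropDiag_of_weakLiftDiag
    (hT : ∃ C : ℕ, ∀ s : ℕ, TropRootLawAt (2 ^ s) (s ^ 2) (2 ^ (C * s ^ 2)))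
    (hW : ∃ C : ℕ, ∀ s n : ℕ, TropRootLawAt (2 ^ s) (s ^ 2) n →
      RealRootLawAt (2 ^ s) (s ^ 2) (2 ^ (C * s ^ 2) * (n + 1))) :
    KPlusLogSqLaw := by
  obtain ⟨CT, hT⟩ := hT
  obtain ⟨CW, hW⟩ := hW
  refine kPlusLogSqLaw_iff_diagonal.mpr ⟨CW + CT + 1, fun s => ?_⟩
  rcases Nat.eq_zero_or_pos s with rfl | hs
  · have h0 : (0 : ℕ) ^ 2 = 0 := by norm_num
    rw [h0]
    exact realRootLawAt_zero _ _
  refine realRootLawAt_mono ?_ (hW s _ (hT s))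
  have e1 : 2 ^ (CT * s ^ 2) + 1 ≤ 2 ^ (CT * s ^ 2 + 1) := two_pow_add_one_le _
  have hs2 : 1 ≤ s ^ 2 := Nat.one_le_pow _ _ hs
  calc 2 ^ (CW * s ^ 2) * (2 ^ (CT * s ^ 2) + 1)
      ≤ 2 ^ (CW * s ^ 2) * 2 ^ (CT * s ^ 2 + 1) := Nat.mul_le_mul_left _ e1
    _ = 2 ^ (CW * s ^ 2 + (CT * s ^ 2 + 1)) := (pow_add _ _ _).symm
    _ ≤ 2 ^ ((CW + CT + 1) * s ^ 2) := Nat.pow_le_pow_right two_pos (by nlinarith)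

/-- **B ⟺ TB_diag ∧ W_diag.**  Conjecture B is the conjunction of two statements about the single format sequence
`(2^s, s²)`: the tropical diagonal law `T(2^s, s²) ≤ 2^(O(s²))` and the weak diagonal
`ζ_tot(2^s, s²) ≤ 2^(O(s²))·(T(2^s, s²) + 1)`.  (`→`: patchworking `tropKPlusLogSqLaw_of_kPlusLogSqLaw` and
`tropicalB_iff_diagonal`; `B → W` outright.) [folklore] -/
theorem kPlusLogSqLaw_iff_tropDiag_and_weakLiftDiag :
    KPlusLogSqLaw ↔
      (∃ C : ℕ, ∀ s : ℕ, TropRootLawAt (2 ^ s) (s ^ 2) (2 ^ (C * s ^ 2))) ∧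
      (∃ C : ℕ, ∀ s n : ℕ, TropRootLawAt (2 ^ s) (s ^ 2) n →
        RealRootLawAt (2 ^ s) (s ^ 2) (2 ^ (C * s ^ 2) * (n + 1))) := by
  constructor
  · intro h
    have hTB : TropicalB := tropKPlusLogSqLaw_of_kPlusLogSqLaw h
    exact ⟨tropicalB_iff_diagonal.mp hTB, weakLiftDiag_of_weakLifting (weakLifting_of_kPlusLogSqLaw h)⟩
  · exact fun h => kPlusLogSqLaw_of_tropDiag_of_weakLiftDiag h.1 h.2

/-- **Given `TropicalB`, `WeakLifting` is Conjecture B** (the weak bridge p417903 read as an equivalence). [folklore] -/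
theorem weakLifting_iff_kPlusLogSqLaw_of_tropicalB (hT : TropicalB) : WeakLifting ↔ KPlusLogSqLaw :=
  ⟨fun hW => kPlusLogSqLaw_of_weakLifting_of_tropKPlusLogSqLaw hW hT, fun h => weakLifting_of_kPlusLogSqLaw h⟩

/-- **Given `TropicalB`, `WeakLifting ⟺ W_diag`** (custody item #2W: the weak diagonal is a faithful re-cut of the crux
MODULO the route's other crux; unconditionally only `→` is claimed, `weakLiftDiag_of_weakLifting`). [folklore] -/
theorem weakLifting_iff_weakLiftDiag_of_tropicalB (hT : TropicalB) :
    WeakLifting ↔ ∃ C : ℕ, ∀ s n : ℕ, TropRootLawAt (2 ^ s) (s ^ 2) n →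
      RealRootLawAt (2 ^ s) (s ^ 2) (2 ^ (C * s ^ 2) * (n + 1)) := by
  constructor
  · exact fun hW => weakLiftDiag_of_weakLifting hW
  · intro hD
    exact weakLifting_of_kPlusLogSqLaw
      (kPlusLogSqLaw_of_tropDiag_of_weakLiftDiag (tropicalB_iff_diagonal.mp hT) hD)

end Summit.ValiantsHypothesis.ValiantsHypothesis.Theorems.KPlusLogSqLaw
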